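/-
Copyright (c) 2026 the pub-hodgecm-mathlib formalisation cell (harness21).  Prover seat hodgecm-mathlib-K2Liu-p23 (g2), Track B «K2-LIT»,
#184♮ = hLiu418 = `stmt-HodgeConjecture-24832`; #42F′ FACE-G organ F4 (G-gen), road (E) (RULINGS M-158r/s/u), THE BRIDGE «(A) invariant-theory rings →
(F) Fock ring», part 2: THE LETTER (FFT) OF ★ (E-f) AT THE FOCK INSTANCE (F4 lead K2Liu-p27 (g2) 2026-09-04T23:13:35Z ∕ 23:15:26Z (B); LEAD F0P6-plan
(g14) BATCH #128).
KERNEL: theorems only.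
-/
import Summits.HodgeConjecture.HodgeConjecture.Theorems.K2LiuFockPolySubstBridge   -- part 1: § 1 the `K_H`-substitution on the blocks, § 2 the coefficient machinery `Θ`
import Mathlib.LinearAlgebra.Dimension.Finite
import Mathlib.LinearAlgebra.FiniteDimensional.Defs
import Mathlib.Algebra.Algebra.Operations
import HarnessLib

/-!
# Crux `HLiu418`, FACE-G organ F4, road (E): THE BRIDGE, part 2 — `K_H = U(R) × U(S)`-invariant Fock polynomials are spanned by the balanced
# products `(∏ C^R)(∏ C^S)` of contractions, GIVEN the two block first fundamental theorems

Cell `hodgecm-mathlib`, crux item hLiu418 = `stmt-HodgeConjecture-24832`, route of record `HCCMUnconditional`; squad K2 ∕ K2Liu, road `K2_Liu`,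
socket #42F′, FACE-G organ F4 (G-gen) under RULING M-158r «(E) COMPACT SEE-SAW + FFT + PBW INDUCTION + `K_H`-AVERAGING» (K2E5-r02 (g6)); F4 lead
K2Liu-p27 (g2), desks K2Liu-p10 (g6) ∕ K2E5-r02 (g6).  THEOREMS ONLY (no `def`, no `instance`, no `notation`, no named-fact hypothesis, no `sorry`);
lane `--supports stmt-HodgeConjecture-24832 --as helper` (count-neutral helper).

SETTING (part 1 `K2LiuFockPolySubstBridge`): the Fock ring `𝒫 = MvPolynomial (DPIdx P Q R S) ℂ`; the block rings `A_R = MvPolynomial ((P × R) ⊕ (Q × R)) ℂ`,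
`A_S = MvPolynomial ((Q × S) ⊕ (P × S)) ℂ` embedded by `ιR = rename (Sum.map inl inr)`, `ιS = rename (Sum.map inr inl)`; the `K_H`-element `(1,(c,d))` acts on
`𝒫` by ★ `linSubst (star ↑(dualPairι (1,(c,d))))`, which on `ιR A_R` is (E-a0)'s substitution `σ_c` (`x ↦ x·c`, `y ↦ y·c̄`) and on `ιS A_S` is `σ_d`
(part 1, § 1); `Θ : 𝒫 → A_R[S-variables]` reads off `A_R`-coefficients (part 1, § 2).

WHAT IS HERE (all proved):
* § 3 **`mem_span_mul_of_invariant`** — TENSOR INVARIANTS ARE PRODUCTS OF INVARIANTS: under the two BLOCK first fundamental theorems (hypotheses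
  `hR`: a `U(R)`-invariant element of `A_R` lies in `Algebra.adjoin ℂ {Σ_r x^R_{(p,r)} y^R_{(q,r)}}`; `hS`: the `S`-twin), every `F ∈ 𝒫` fixed by all
  `linSubst (star ↑(dualPairι (1,(c,d))))` lies in `span {ιR b · ιS b′ : b ∈ adjoin (contr^R), b′ ∈ adjoin (contr^S)}`.  PROOF without `TensorProduct`:
  expand `F = Σ_ν ιR (a_ν) ιS (X^ν)`; `U(R)`-invariance + coefficient extraction ⇒ `a_ν` invariant ⇒ `a_ν ∈ B_R`; write the `a_ν` in a basis `β_l` of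
  their finite-dimensional span, `F = Σ_l ιR (β_l) ιS (g_l)`; `U(S)`-invariance + coefficient extraction + independence of the `β_l` ⇒ `g_l` invariant
  ⇒ `g_l ∈ B_S`.
* § 4 **`fft_fock_of_fft_blocks`** (and `…_prod`, uncurried `K_H`) — the letter **(FFT)** of ★ (E-f) `K2LiuLocalThetaCyclicUniform.map_mem_of_cyclicLetters`
  VERBATIM at the Fock instance: `∀ F, (∀ c d, linSubst (star ↑(dualPairι (1,(c,d)))) F = F) → F ∈ Submodule.span ℂ {x | ∃ ρ τ : List (P × Q),
  x = (ρ.map CR).prod * (τ.map CS).prod}` with ★ (E-b)'s inline `CR i = Σ_r X (inl (inl (i.1,r))) * X (inr (inr (i.2,r)))`,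
  `CS i = Σ_s X (inr (inl (i.1,s))) * X (inl (inr (i.2,s)))` (`Algebra.adjoin = span ∘ Submonoid.closure`, list products, `Submodule.span_mul_span`).

The block hypotheses `hR`, `hS` are the first fundamental theorem for `U(p)` [cite: Weyl1939, Thm. 2.6.A] [cite: GoodmanWallachGTM255, Thm. 5.2.1] in
abstract-index (E-a0) currency (`x_{(i,a)} ↦ Σ_b x_{(i,b)} c_{ba}`, `y_{(j,a)} ↦ Σ_b y_{(j,b)} (star c)_{ab}`); they are DISCHARGED at `P = Q = Fin 2` by
★ `Literature.RepresentationTheory.ClassicalInvariants.GeneralLinearPolynomialFFTGeneral` through K2E1-p10 (g4)'s adapter `K2LiuUnitaryFFTContractions`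
(+ ★ (E-a1) `K2LiuUnitaryZariskiDensity`) and one reindexing `R ≃ Fin |R|` (ED. 2 of this file).  Degenerate instances (`R = ∅` or `S = ∅`) are covered
as written.
References: [Howe1989Remarks] §2–§3; [KashiwaraVergne1978] §II; [Weyl1939] Ch. II §6 Thm. 2.6.A; [GoodmanWallachGTM255] §5.2.1 Thm. 5.2.1.
HONEST LABEL.  Count-neutral helper; it retires nothing by itself: `HC_CM` is proved only modulo the 7 printed citations (2 remaining named inputs:
hLiu418 = `stmt-HodgeConjecture-24832`, h413 = `stmt-HodgeConjecture-24833`) until rung 0 closes.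

## References
* [Howe1989Remarks] R. Howe, *Remarks on classical invariant theory*, Trans. AMS 313 (1989), §2–§3.
* [KashiwaraVergne1978] M. Kashiwara, M. Vergne, *On the Segal–Shale–Weil representations and harmonic polynomials*, Invent. Math. 44 (1978), §II.
* [Weyl1939] H. Weyl, *The Classical Groups*, Princeton (1939), Ch. II §6, Thm. 2.6.A.
* [GoodmanWallachGTM255] R. Goodman, N. R. Wallach, *Symmetry, Representations, and Invariants*, GTM 255 (2009), Thm. 5.2.1.
-/

set_option autoImplicit false
set_option linter.dupNamespace false -- the mandated namespace repeats `HodgeConjecture.HodgeConjecture`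

open scoped BigOperators
open MvPolynomial Matrix
open Literature.Analysis.SegalBargmann
open Summit.HodgeConjecture.HodgeConjecture.Cruxes.HLiu418.K2LiuFockPolySubstBridge

namespace Summit.HodgeConjecture.HodgeConjecture.Cruxes.HLiu418.K2LiuFockInvariantsOfBlocks

variable {P Q R S : Type*} [Fintype P] [DecidableEq P] [Fintype Q] [DecidableEq Q] [Fintype R] [DecidableEq R]
  [Fintype S] [DecidableEq S]

/-! ## § 3 Tensor invariants are products of invariants -/

/-- **TENSOR INVARIANTS ARE PRODUCTS OF INVARIANTS.**  Assume the two BLOCK first fundamental theorems (`hR`: a `U(R)`-invariant polynomial in the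
`R`-variables `x^R_{(p,r)}, y^R_{(q,r)}` — `x^R ↦ x^R·c`, `y^R ↦ y^R·c̄` — lies in the subalgebra generated by the contractions `Σ_r x^R_{(p,r)} y^R_{(q,r)}`;
`hS`: the `S`-twin).  Then every Fock polynomial `F` fixed by all `K_H`-substitutions `linSubst (star ↑(dualPairι (1,(c,d))))`, `c ∈ U(R)`, `d ∈ U(S)`,
is a finite sum `Σ_l ιR (b_l) · ιS (b′_l)` with `b_l`, `b′_l` in those two subalgebras.  PROOF: expand `F = Σ_ν ιR (a_ν) ιS (X^ν)` (§ 2); `U(R)`-invariance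
and coefficient extraction make every `a_ν` invariant, so `a_ν ∈ B_R` (`hR`); write the `a_ν` in a basis `β_l` of their (finite-dimensional) span,
`F = Σ_l ιR (β_l) ιS (g_l)`; `U(S)`-invariance, coefficient extraction and the linear independence of the `β_l` make every `g_l` invariant, so `g_l ∈ B_S`
(`hS`). [cite: Howe1989Remarks, §3] [cite: KashiwaraVergne1978, §II] -/
theorem mem_span_mul_of_invariant
    (hR : ∀ f : MvPolynomial ((P × R) ⊕ (Q × R)) ℂ,
      (∀ c : Matrix.unitaryGroup R ℂ, aeval (Sum.elim (fun pr : P × R => ∑ b : R, X (Sum.inl (pr.1, b)) * C ((c : Matrix R R ℂ) b pr.2))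
          (fun qr : Q × R => ∑ b : R, X (Sum.inr (qr.1, b)) * C ((star (c : Matrix R R ℂ)) qr.2 b)) :
            (P × R) ⊕ (Q × R) → MvPolynomial ((P × R) ⊕ (Q × R)) ℂ) f = f) →
        f ∈ Algebra.adjoin ℂ (Set.range fun ij : P × Q =>
          (∑ r : R, X (Sum.inl (ij.1, r)) * X (Sum.inr (ij.2, r)) : MvPolynomial ((P × R) ⊕ (Q × R)) ℂ)))
    (hS : ∀ g : MvPolynomial ((Q × S) ⊕ (P × S)) ℂ,
      (∀ d : Matrix.unitaryGroup S ℂ, aeval (Sum.elim (fun pr : Q × S => ∑ b : S, X (Sum.inl (pr.1, b)) * C ((d : Matrix S S ℂ) b pr.2))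
          (fun qr : P × S => ∑ b : S, X (Sum.inr (qr.1, b)) * C ((star (d : Matrix S S ℂ)) qr.2 b)) :
            (Q × S) ⊕ (P × S) → MvPolynomial ((Q × S) ⊕ (P × S)) ℂ) g = g) →
        g ∈ Algebra.adjoin ℂ (Set.range fun ij : P × Q =>
          (∑ s : S, X (Sum.inl (ij.2, s)) * X (Sum.inr (ij.1, s)) : MvPolynomial ((Q × S) ⊕ (P × S)) ℂ)))
    (F : MvPolynomial (DPIdx P Q R S) ℂ)
    (hF : ∀ (c : Matrix.unitaryGroup R ℂ) (d : Matrix.unitaryGroup S ℂ),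
      linSubst (star ((dualPairι ((1, (c, d)) : DPK P Q R S) : Matrix.unitaryGroup (DPIdx P Q R S) ℂ) :
        Matrix (DPIdx P Q R S) (DPIdx P Q R S) ℂ)) F = F) :
    F ∈ Submodule.span ℂ {x : MvPolynomial (DPIdx P Q R S) ℂ |
      ∃ (b : MvPolynomial ((P × R) ⊕ (Q × R)) ℂ) (b' : MvPolynomial ((Q × S) ⊕ (P × S)) ℂ),
        b ∈ Algebra.adjoin ℂ (Set.range fun ij : P × Q =>
          (∑ r : R, X (Sum.inl (ij.1, r)) * X (Sum.inr (ij.2, r)) : MvPolynomial ((P × R) ⊕ (Q × R)) ℂ)) ∧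
        b' ∈ Algebra.adjoin ℂ (Set.range fun ij : P × Q =>
          (∑ s : S, X (Sum.inl (ij.2, s)) * X (Sum.inr (ij.1, s)) : MvPolynomial ((Q × S) ⊕ (P × S)) ℂ)) ∧
        x = rename (Sum.map Sum.inl Sum.inr : (P × R) ⊕ (Q × R) → DPIdx P Q R S) b *
          rename (Sum.map Sum.inr Sum.inl : (Q × S) ⊕ (P × S) → DPIdx P Q R S) b'} := by
  classical
  -- the `A_R`-coefficients `a ν` of `F` along the `S`-monomials, and their support `T`
  set T := (aeval (Sum.elim
          (Sum.elim (fun pr : P × R => C (X (Sum.inl pr) : MvPolynomial ((P × R) ⊕ (Q × R)) ℂ)) (fun qs : Q × S => X (Sum.inl qs)))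
          (Sum.elim (fun ps : P × S => X (Sum.inr ps)) (fun qr : Q × R => C (X (Sum.inr qr) : MvPolynomial ((P × R) ⊕ (Q × R)) ℂ))) :
          DPIdx P Q R S → MvPolynomial ((Q × S) ⊕ (P × S)) (MvPolynomial ((P × R) ⊕ (Q × R)) ℂ)) F).support with hT
  set a : ((Q × S) ⊕ (P × S) →₀ ℕ) → MvPolynomial ((P × R) ⊕ (Q × R)) ℂ := fun ν =>
    coeff ν (aeval (Sum.elim
          (Sum.elim (fun pr : P × R => C (X (Sum.inl pr) : MvPolynomial ((P × R) ⊕ (Q × R)) ℂ)) (fun qs : Q × S => X (Sum.inl qs)))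
          (Sum.elim (fun ps : P × S => X (Sum.inr ps)) (fun qr : Q × R => C (X (Sum.inr qr) : MvPolynomial ((P × R) ⊕ (Q × R)) ℂ))) :
          DPIdx P Q R S → MvPolynomial ((Q × S) ⊕ (P × S)) (MvPolynomial ((P × R) ⊕ (Q × R)) ℂ)) F) with ha
  have hexp : F = ∑ ν ∈ T, rename (Sum.map Sum.inl Sum.inr : (P × R) ⊕ (Q × R) → DPIdx P Q R S) (a ν) *
      rename (Sum.map Sum.inr Sum.inl : (Q × S) ⊕ (P × S) → DPIdx P Q R S) (monomial ν (1 : ℂ)) :=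
    eq_sum_rename_coeff_theta F
  -- STEP A: every `a ν` is `U(R)`-invariant, hence (hR) in `B_R`
  have hainv : ∀ (c : Matrix.unitaryGroup R ℂ) (ν : (Q × S) ⊕ (P × S) →₀ ℕ),
      aeval (Sum.elim (fun pr : P × R => ∑ b : R, X (Sum.inl (pr.1, b)) * C ((c : Matrix R R ℂ) b pr.2))
          (fun qr : Q × R => ∑ b : R, X (Sum.inr (qr.1, b)) * C ((star (c : Matrix R R ℂ)) qr.2 b)) :
            (P × R) ⊕ (Q × R) → MvPolynomial ((P × R) ⊕ (Q × R)) ℂ) (a ν) = a ν := by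
    intro c ν
    have h1 := hF c 1
    have h2 : linSubst (star ((dualPairι ((1, (c, 1)) : DPK P Q R S) : Matrix.unitaryGroup (DPIdx P Q R S) ℂ) :
        Matrix (DPIdx P Q R S) (DPIdx P Q R S) ℂ)) F =
        ∑ ν ∈ T, rename (Sum.map Sum.inl Sum.inr : (P × R) ⊕ (Q × R) → DPIdx P Q R S)
          (aeval (Sum.elim (fun pr : P × R => ∑ b : R, X (Sum.inl (pr.1, b)) * C ((c : Matrix R R ℂ) b pr.2))
          (fun qr : Q × R => ∑ b : R, X (Sum.inr (qr.1, b)) * C ((star (c : Matrix R R ℂ)) qr.2 b)) :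
            (P × R) ⊕ (Q × R) → MvPolynomial ((P × R) ⊕ (Q × R)) ℂ) (a ν)) *
          rename (Sum.map Sum.inr Sum.inl : (Q × S) ⊕ (P × S) → DPIdx P Q R S) (monomial ν (1 : ℂ)) := by
      conv_lhs => rw [hexp]
      rw [map_sum]
      refine Finset.sum_congr rfl fun ν _ => ?_
      rw [map_mul, linSubst_dualPairι_rename_R, linSubst_dualPairι_rename_S, aeval_sigma_one]
    have h3 := congrArg (fun H => coeff ν (aeval (Sum.elim
          (Sum.elim (fun pr : P × R => C (X (Sum.inl pr) : MvPolynomial ((P × R) ⊕ (Q × R)) ℂ)) (fun qs : Q × S => X (Sum.inl qs)))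
          (Sum.elim (fun ps : P × S => X (Sum.inr ps)) (fun qr : Q × R => C (X (Sum.inr qr) : MvPolynomial ((P × R) ⊕ (Q × R)) ℂ))) :
          DPIdx P Q R S → MvPolynomial ((Q × S) ⊕ (P × S)) (MvPolynomial ((P × R) ⊕ (Q × R)) ℂ)) H))
      (h2.symm.trans (h1.trans hexp))
    rw [coeff_theta_sum, coeff_theta_sum] at h3
    simp only [coeff_monomial, ite_smul, one_smul, zero_smul, Finset.sum_ite_eq', hT] at h3
    by_cases hν : ν ∈ (aeval (Sum.elim
          (Sum.elim (fun pr : P × R => C (X (Sum.inl pr) : MvPolynomial ((P × R) ⊕ (Q × R)) ℂ)) (fun qs : Q × S => X (Sum.inl qs)))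
          (Sum.elim (fun ps : P × S => X (Sum.inr ps)) (fun qr : Q × R => C (X (Sum.inr qr) : MvPolynomial ((P × R) ⊕ (Q × R)) ℂ))) :
          DPIdx P Q R S → MvPolynomial ((Q × S) ⊕ (P × S)) (MvPolynomial ((P × R) ⊕ (Q × R)) ℂ)) F).support
    · simpa only [hν, if_true] using h3
    · have h0 : a ν = 0 := by simpa only [ha] using notMem_support_iff.mp hν
      rw [h0, map_zero]
  have hamem : ∀ ν, a ν ∈ Algebra.adjoin ℂ (Set.range fun ij : P × Q =>
          (∑ r : R, X (Sum.inl (ij.1, r)) * X (Sum.inr (ij.2, r)) : MvPolynomial ((P × R) ⊕ (Q × R)) ℂ)) := fun ν => hR (a ν) fun c => hainv c ν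
  -- STEP B: a basis `β` of the span `W` of the coefficients; `F = Σ_l ιR (β l) · ιS (g l)`
  set W : Submodule ℂ (MvPolynomial ((P × R) ⊕ (Q × R)) ℂ) := Submodule.span ℂ (a '' (↑T : Set ((Q × S) ⊕ (P × S) →₀ ℕ))) with hW
  haveI : FiniteDimensional ℂ W := FiniteDimensional.span_of_finite ℂ (T.finite_toSet.image a)
  have haW : ∀ ν ∈ T, a ν ∈ W := fun ν hν => Submodule.subset_span (Set.mem_image_of_mem a hν)
  have hWle : W ≤ Subalgebra.toSubmodule (Algebra.adjoin ℂ (Set.range fun ij : P × Q =>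
          (∑ r : R, X (Sum.inl (ij.1, r)) * X (Sum.inr (ij.2, r)) : MvPolynomial ((P × R) ⊕ (Q × R)) ℂ))) := by
    refine Submodule.span_le.mpr ?_
    rintro _ ⟨ν, -, rfl⟩
    exact hamem ν
  set bW := Module.finBasis ℂ W with hbW
  set β : Fin (Module.finrank ℂ W) → MvPolynomial ((P × R) ⊕ (Q × R)) ℂ := fun l => (bW l : MvPolynomial ((P × R) ⊕ (Q × R)) ℂ) with hβ
  have hβmem : ∀ l, β l ∈ Algebra.adjoin ℂ (Set.range fun ij : P × Q =>
          (∑ r : R, X (Sum.inl (ij.1, r)) * X (Sum.inr (ij.2, r)) : MvPolynomial ((P × R) ⊕ (Q × R)) ℂ)) := fun l => hWle (bW l).2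
  have hβli : LinearIndependent ℂ β := bW.linearIndependent.map' W.subtype (Submodule.ker_subtype W)
  set r : ((Q × S) ⊕ (P × S) →₀ ℕ) → Fin (Module.finrank ℂ W) → ℂ := fun ν l =>
    if hν : ν ∈ T then bW.repr ⟨a ν, haW ν hν⟩ l else 0 with hr
  have har : ∀ ν ∈ T, a ν = ∑ l, r ν l • β l := by
    intro ν hν
    have h1 := congrArg Subtype.val (bW.sum_repr ⟨a ν, haW ν hν⟩)
    simp only [Submodule.coe_sum, Submodule.coe_smul] at h1
    rw [← h1]
    refine Finset.sum_congr rfl fun l _ => ?_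
    simp only [hr, hν, dif_pos, hβ]
  set g : Fin (Module.finrank ℂ W) → MvPolynomial ((Q × S) ⊕ (P × S)) ℂ := fun l => ∑ ν ∈ T, r ν l • monomial ν (1 : ℂ) with hg
  have hexp2 : F = ∑ l, rename (Sum.map Sum.inl Sum.inr : (P × R) ⊕ (Q × R) → DPIdx P Q R S) (β l) *
      rename (Sum.map Sum.inr Sum.inl : (Q × S) ⊕ (P × S) → DPIdx P Q R S) (g l) := by
    rw [hexp]
    calc ∑ ν ∈ T, rename (Sum.map Sum.inl Sum.inr : (P × R) ⊕ (Q × R) → DPIdx P Q R S) (a ν) *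
            rename (Sum.map Sum.inr Sum.inl : (Q × S) ⊕ (P × S) → DPIdx P Q R S) (monomial ν (1 : ℂ))
        = ∑ ν ∈ T, ∑ l, r ν l • (rename (Sum.map Sum.inl Sum.inr : (P × R) ⊕ (Q × R) → DPIdx P Q R S) (β l) *
            rename (Sum.map Sum.inr Sum.inl : (Q × S) ⊕ (P × S) → DPIdx P Q R S) (monomial ν (1 : ℂ))) := by
          refine Finset.sum_congr rfl fun ν hν => ?_
          rw [har ν hν, map_sum, Finset.sum_mul]
          refine Finset.sum_congr rfl fun l _ => ?_
          rw [map_smul, smul_mul_assoc]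
      _ = ∑ l, ∑ ν ∈ T, r ν l • (rename (Sum.map Sum.inl Sum.inr : (P × R) ⊕ (Q × R) → DPIdx P Q R S) (β l) *
            rename (Sum.map Sum.inr Sum.inl : (Q × S) ⊕ (P × S) → DPIdx P Q R S) (monomial ν (1 : ℂ))) := Finset.sum_comm
      _ = ∑ l, rename (Sum.map Sum.inl Sum.inr : (P × R) ⊕ (Q × R) → DPIdx P Q R S) (β l) *
            rename (Sum.map Sum.inr Sum.inl : (Q × S) ⊕ (P × S) → DPIdx P Q R S) (g l) := by
          refine Finset.sum_congr rfl fun l _ => ?_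
          simp only [hg, map_sum, map_smul, Finset.mul_sum, mul_smul_comm]
  -- STEP C: every `g l` is `U(S)`-invariant (coefficient extraction + independence of `β`), hence (hS) in `B_S`
  have hginv : ∀ (d : Matrix.unitaryGroup S ℂ) (l : Fin (Module.finrank ℂ W)),
      aeval (Sum.elim (fun pr : Q × S => ∑ b : S, X (Sum.inl (pr.1, b)) * C ((d : Matrix S S ℂ) b pr.2))
          (fun qr : P × S => ∑ b : S, X (Sum.inr (qr.1, b)) * C ((star (d : Matrix S S ℂ)) qr.2 b)) :
            (Q × S) ⊕ (P × S) → MvPolynomial ((Q × S) ⊕ (P × S)) ℂ) (g l) = g l := by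
    intro d l
    have h1 := hF 1 d
    have h2 : linSubst (star ((dualPairι ((1, (1, d)) : DPK P Q R S) : Matrix.unitaryGroup (DPIdx P Q R S) ℂ) :
        Matrix (DPIdx P Q R S) (DPIdx P Q R S) ℂ)) F =
        ∑ l, rename (Sum.map Sum.inl Sum.inr : (P × R) ⊕ (Q × R) → DPIdx P Q R S) (β l) *
          rename (Sum.map Sum.inr Sum.inl : (Q × S) ⊕ (P × S) → DPIdx P Q R S)
            (aeval (Sum.elim (fun pr : Q × S => ∑ b : S, X (Sum.inl (pr.1, b)) * C ((d : Matrix S S ℂ) b pr.2))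
          (fun qr : P × S => ∑ b : S, X (Sum.inr (qr.1, b)) * C ((star (d : Matrix S S ℂ)) qr.2 b)) :
            (Q × S) ⊕ (P × S) → MvPolynomial ((Q × S) ⊕ (P × S)) ℂ) (g l)) := by
      conv_lhs => rw [hexp2]
      rw [map_sum]
      refine Finset.sum_congr rfl fun l _ => ?_
      rw [map_mul, linSubst_dualPairι_rename_R, linSubst_dualPairι_rename_S, aeval_sigma_one]
    refine MvPolynomial.ext _ _ fun ν => ?_
    have h3 := congrArg (fun H => coeff ν (aeval (Sum.elim
          (Sum.elim (fun pr : P × R => C (X (Sum.inl pr) : MvPolynomial ((P × R) ⊕ (Q × R)) ℂ)) (fun qs : Q × S => X (Sum.inl qs)))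
          (Sum.elim (fun ps : P × S => X (Sum.inr ps)) (fun qr : Q × R => C (X (Sum.inr qr) : MvPolynomial ((P × R) ⊕ (Q × R)) ℂ))) :
          DPIdx P Q R S → MvPolynomial ((Q × S) ⊕ (P × S)) (MvPolynomial ((P × R) ⊕ (Q × R)) ℂ)) H))
      (h2.symm.trans (h1.trans hexp2))
    rw [coeff_theta_sum, coeff_theta_sum] at h3
    have h4 : ∑ l', (coeff ν (aeval (Sum.elim (fun pr : Q × S => ∑ b : S, X (Sum.inl (pr.1, b)) * C ((d : Matrix S S ℂ) b pr.2))
          (fun qr : P × S => ∑ b : S, X (Sum.inr (qr.1, b)) * C ((star (d : Matrix S S ℂ)) qr.2 b)) :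
            (Q × S) ⊕ (P × S) → MvPolynomial ((Q × S) ⊕ (P × S)) ℂ) (g l')) - coeff ν (g l')) • β l' = 0 := by
      simp only [sub_smul, Finset.sum_sub_distrib, h3, sub_self]
    exact sub_eq_zero.mp (Fintype.linearIndependent_iff.mp hβli _ h4 l)
  have hgmem : ∀ l, g l ∈ Algebra.adjoin ℂ (Set.range fun ij : P × Q =>
          (∑ s : S, X (Sum.inl (ij.2, s)) * X (Sum.inr (ij.1, s)) : MvPolynomial ((Q × S) ⊕ (P × S)) ℂ)) := fun l => hS (g l) fun d => hginv d l
  -- STEP D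
  rw [hexp2]
  exact Submodule.sum_mem _ fun l _ => Submodule.subset_span ⟨β l, g l, hβmem l, hgmem l, rfl⟩


/-! ## § 4 The letter (FFT) of ★ (E-f) `K2LiuLocalThetaCyclicUniform` at the Fock instance -/

/-- a list of elements of `Set.range f` is the `f`-image of a list. [folklore] -/
theorem exists_map_eq_of_forall_mem_range {α β : Type*} (f : α → β) :
    ∀ l : List β, (∀ y ∈ l, y ∈ Set.range f) → ∃ ρ : List α, ρ.map f = l
  | [], _ => ⟨[], rfl⟩
  | y :: l, h => by
      obtain ⟨a, rfl⟩ := h y List.mem_cons_self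
      obtain ⟨ρ, hρ⟩ := exists_map_eq_of_forall_mem_range f l fun z hz => h z (List.mem_cons_of_mem _ hz)
      exact ⟨a :: ρ, by rw [List.map_cons, hρ]⟩

/-- **the image of `Algebra.adjoin ℂ (range c)` under an algebra map lies in the span of the products of lists of images of the generators**
(`Algebra.adjoin = span ∘ Submonoid.closure`, and the closure of a range consists of list products). [folklore] -/
theorem map_mem_span_listProd_of_mem_adjoin {A B : Type*} [CommRing A] [Algebra ℂ A] [CommRing B] [Algebra ℂ B] {ι : Type*} (c : ι → A)
    (φ : A →ₐ[ℂ] B) {b : A} (hb : b ∈ Algebra.adjoin ℂ (Set.range c)) :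
    φ b ∈ Submodule.span ℂ {x : B | ∃ ρ : List ι, x = (ρ.map fun i => φ (c i)).prod} := by
  have hb' : b ∈ Subalgebra.toSubmodule (Algebra.adjoin ℂ (Set.range c)) := hb
  rw [Algebra.adjoin_eq_span] at hb'
  have h1 : φ b ∈ Submodule.map φ.toLinearMap (Submodule.span ℂ (↑(Submonoid.closure (Set.range c)) : Set A)) :=
    Submodule.mem_map_of_mem hb'
  rw [Submodule.map_span] at h1
  refine Submodule.span_mono ?_ h1
  rintro _ ⟨m, hm, rfl⟩
  obtain ⟨l, hl, rfl⟩ := Submonoid.exists_list_of_mem_closure hm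
  obtain ⟨ρ, rfl⟩ := exists_map_eq_of_forall_mem_range c l hl
  refine ⟨ρ, ?_⟩
  rw [AlgHom.toLinearMap_apply, map_list_prod, List.map_map]
  rfl

/-- **THE LETTER (FFT) OF ★ (E-f) AT THE FOCK INSTANCE, FROM THE TWO BLOCK FIRST FUNDAMENTAL THEOREMS**: every Fock polynomial fixed by all
`K_H`-substitutions `linSubst (star ↑(dualPairι (1,(c,d))))` (`c ∈ U(R)`, `d ∈ U(S)`) lies in the `ℂ`-span of the balanced products
`(∏_ρ C^R)(∏_τ C^S)` of ★ (E-b)'s contractions `C^R_{(p,q)} = Σ_r X (inl (inl (p,r))) * X (inr (inr (q,r)))`, `C^S_{(p,q)} = Σ_s X (inr (inl (p,s))) * X (inl (inr (q,s)))`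
— VERBATIM the hypothesis `hFFT` of ★ `K2LiuLocalThetaCyclicUniform.map_mem_of_cyclicLetters` with `subst (c,d) := linSubst (star ↑(dualPairι (1,(c,d))))`.
The block hypotheses `hR`, `hS` are the first fundamental theorem for `U(p)` [cite: Weyl1939, Thm. 2.6.A] [cite: GoodmanWallachGTM255, Thm. 5.2.1] in
abstract-index (E-a0) currency. [cite: Howe1989Remarks, §3] -/
theorem fft_fock_of_fft_blocks
    (hR : ∀ f : MvPolynomial ((P × R) ⊕ (Q × R)) ℂ,
      (∀ c : Matrix.unitaryGroup R ℂ, aeval (Sum.elim (fun pr : P × R => ∑ b : R, X (Sum.inl (pr.1, b)) * C ((c : Matrix R R ℂ) b pr.2))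
          (fun qr : Q × R => ∑ b : R, X (Sum.inr (qr.1, b)) * C ((star (c : Matrix R R ℂ)) qr.2 b)) :
            (P × R) ⊕ (Q × R) → MvPolynomial ((P × R) ⊕ (Q × R)) ℂ) f = f) →
        f ∈ Algebra.adjoin ℂ (Set.range fun ij : P × Q =>
          (∑ r : R, X (Sum.inl (ij.1, r)) * X (Sum.inr (ij.2, r)) : MvPolynomial ((P × R) ⊕ (Q × R)) ℂ)))
    (hS : ∀ g : MvPolynomial ((Q × S) ⊕ (P × S)) ℂ,
      (∀ d : Matrix.unitaryGroup S ℂ, aeval (Sum.elim (fun pr : Q × S => ∑ b : S, X (Sum.inl (pr.1, b)) * C ((d : Matrix S S ℂ) b pr.2))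
          (fun qr : P × S => ∑ b : S, X (Sum.inr (qr.1, b)) * C ((star (d : Matrix S S ℂ)) qr.2 b)) :
            (Q × S) ⊕ (P × S) → MvPolynomial ((Q × S) ⊕ (P × S)) ℂ) g = g) →
        g ∈ Algebra.adjoin ℂ (Set.range fun ij : P × Q =>
          (∑ s : S, X (Sum.inl (ij.2, s)) * X (Sum.inr (ij.1, s)) : MvPolynomial ((Q × S) ⊕ (P × S)) ℂ)))
    (F : MvPolynomial (DPIdx P Q R S) ℂ)
    (hF : ∀ (c : Matrix.unitaryGroup R ℂ) (d : Matrix.unitaryGroup S ℂ),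
      linSubst (star ((dualPairι (((1, (c, d))) : DPK P Q R S) : Matrix.unitaryGroup (DPIdx P Q R S) ℂ) :
        Matrix (DPIdx P Q R S) (DPIdx P Q R S) ℂ)) F = F) :
    F ∈ Submodule.span ℂ {x : MvPolynomial (DPIdx P Q R S) ℂ | ∃ ρ τ : List (P × Q),
      x = (ρ.map fun i : P × Q =>
            (∑ r : R, X (Sum.inl (Sum.inl (i.1, r))) * X (Sum.inr (Sum.inr (i.2, r))) : MvPolynomial (DPIdx P Q R S) ℂ)).prod *
          (τ.map fun i : P × Q =>
            (∑ s : S, X (Sum.inr (Sum.inl (i.1, s))) * X (Sum.inl (Sum.inr (i.2, s))) : MvPolynomial (DPIdx P Q R S) ℂ)).prod} := by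
  have h3 := mem_span_mul_of_invariant hR hS F hF
  refine (Submodule.span_le.mpr ?_) h3
  rintro x ⟨b, b', hb, hb', rfl⟩
  have hb1 := map_mem_span_listProd_of_mem_adjoin _ (rename (Sum.map Sum.inl Sum.inr : (P × R) ⊕ (Q × R) → DPIdx P Q R S)) hb
  have hb2 := map_mem_span_listProd_of_mem_adjoin _ (rename (Sum.map Sum.inr Sum.inl : (Q × S) ⊕ (P × S) → DPIdx P Q R S)) hb'
  simp only [rename_contractionR, rename_contractionS] at hb1 hb2
  have h := Submodule.mul_mem_mul hb1 hb2
  rw [Submodule.span_mul_span] at h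
  refine Submodule.span_mono ?_ h
  rintro _ ⟨u, ⟨ρ, rfl⟩, v, ⟨τ, rfl⟩, rfl⟩
  exact ⟨ρ, τ, rfl⟩

/-- **THE LETTER (FFT), UNCURRIED `K_H`**: the same with the `K_H`-invariance hypothesis over `k : U(R) × U(S)` (the shape of ★ (E-f)'s
`subst : G → A →ₗ[ℂ] A` at `G := U(R) × U(S)`, `subst k := (linSubst (star ↑(dualPairι (1,k)))).toLinearMap`). [cite: Howe1989Remarks, §3] -/
theorem fft_fock_of_fft_blocks_prod
    (hR : ∀ f : MvPolynomial ((P × R) ⊕ (Q × R)) ℂ,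
      (∀ c : Matrix.unitaryGroup R ℂ, aeval (Sum.elim (fun pr : P × R => ∑ b : R, X (Sum.inl (pr.1, b)) * C ((c : Matrix R R ℂ) b pr.2))
          (fun qr : Q × R => ∑ b : R, X (Sum.inr (qr.1, b)) * C ((star (c : Matrix R R ℂ)) qr.2 b)) :
            (P × R) ⊕ (Q × R) → MvPolynomial ((P × R) ⊕ (Q × R)) ℂ) f = f) →
        f ∈ Algebra.adjoin ℂ (Set.range fun ij : P × Q =>
          (∑ r : R, X (Sum.inl (ij.1, r)) * X (Sum.inr (ij.2, r)) : MvPolynomial ((P × R) ⊕ (Q × R)) ℂ)))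
    (hS : ∀ g : MvPolynomial ((Q × S) ⊕ (P × S)) ℂ,
      (∀ d : Matrix.unitaryGroup S ℂ, aeval (Sum.elim (fun pr : Q × S => ∑ b : S, X (Sum.inl (pr.1, b)) * C ((d : Matrix S S ℂ) b pr.2))
          (fun qr : P × S => ∑ b : S, X (Sum.inr (qr.1, b)) * C ((star (d : Matrix S S ℂ)) qr.2 b)) :
            (Q × S) ⊕ (P × S) → MvPolynomial ((Q × S) ⊕ (P × S)) ℂ) g = g) →
        g ∈ Algebra.adjoin ℂ (Set.range fun ij : P × Q =>
          (∑ s : S, X (Sum.inl (ij.2, s)) * X (Sum.inr (ij.1, s)) : MvPolynomial ((Q × S) ⊕ (P × S)) ℂ)))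
    (F : MvPolynomial (DPIdx P Q R S) ℂ)
    (hF : ∀ k : Matrix.unitaryGroup R ℂ × Matrix.unitaryGroup S ℂ,
      (linSubst (star ((dualPairι (((1, k)) : DPK P Q R S) : Matrix.unitaryGroup (DPIdx P Q R S) ℂ) :
        Matrix (DPIdx P Q R S) (DPIdx P Q R S) ℂ))).toLinearMap F = F) :
    F ∈ Submodule.span ℂ {x : MvPolynomial (DPIdx P Q R S) ℂ | ∃ ρ τ : List (P × Q),
      x = (ρ.map fun i : P × Q =>
            (∑ r : R, X (Sum.inl (Sum.inl (i.1, r))) * X (Sum.inr (Sum.inr (i.2, r))) : MvPolynomial (DPIdx P Q R S) ℂ)).prod *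
          (τ.map fun i : P × Q =>
            (∑ s : S, X (Sum.inr (Sum.inl (i.1, s))) * X (Sum.inl (Sum.inr (i.2, s))) : MvPolynomial (DPIdx P Q R S) ℂ)).prod} :=
  fft_fock_of_fft_blocks hR hS F fun c d => hF (c, d)

end Summit.HodgeConjecture.HodgeConjecture.Cruxes.HLiu418.K2LiuFockInvariantsOfBlocks
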